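import Summits.CriticalPhenomena.Ising3DConformalLimit.Theorems.MonotoneBlockingMonotoneBlockingTwoKarlinDefs
import Summits.CriticalPhenomena.Ising3DConformalLimit.Theorems.MonotoneBlockingMonotoneBlockingTwoFold
import HarnessLib

/-!
# Stub `foldedBlockIntegral_tp2` of line `Sketch` (idea `karlin-scale-tp2`) for crux `MonotoneBlockingTwo`

Crux `Summit.CriticalPhenomena.Ising3DConformalLimit.Theses.MonotoneBlocking.MonotoneBlockingTwo`
(item stmt-CriticalPhenomena-17054), line `Sketch`, registered stub `Sig.stub_foldedBlockIntegral_tp2`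
of the definitions module `MonotoneBlockingMonotoneBlockingTwoKarlinDefs`.

**The engine.** For a kernel `Γ` of the scale-total-positivity class `KarlinClass`, the folded scaled block
integral `foldedBlockIntegral Γ L n` is multivariate TP₂ in `(L, n) ∈ (0,∞) × ℕ³`, GIVEN the continuous
four-functions theorem on a chain (`Sig.stub_fourFunctions`) and the TP₂ property of the folded tent
(`Sig.stub_foldedTent_tp2`); both are hypotheses of the registered statement and are proved elsewhere.

Proof (three marginalisations, innermost first). The integrand
`Γ(L s₁, L s₂, L s₃) · S(s₁,n₀) S(s₂,n₁) S(s₃,n₂)` is MTP₂ in the seven variables `(L, n, s)` (class axiom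
`KarlinClass.mtp2` for the kernel factor, tent TP₂ for each tent factor, and products of TP₂ pairs are TP₂),
and MTP₂ survives integrating out one real coordinate over `Ioi 0`: this is exactly the four-functions
theorem with `μ = volume`, `S = Ioi 0`, applied to the sections. Writing
`H₁(L,a,b,m) = ∫_{(0,∞)} S(c,m) Γ(La,Lb,Lc) dc` (innermost integral),
`H₂(L,a,m₂,m₃) = ∫_{(0,∞)} S(b,m₂) H₁(L,a,b,m₃) db` and
`H₃(L,m₁,m₂,m₃) = ∫_{(0,∞)} S(a,m₁) H₂(L,a,m₂,m₃) da = foldedBlockIntegral Γ L (m₁,m₂,m₃)` (definitionally),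
we prove the MTP₂ property of `H₁`, `H₂`, `H₃` in turn (`lintegral₁_tp2`, `lintegral₂_tp2`, `lintegral₃_tp2`;
the integrals are kept spelled out, no auxiliary definitions). No Fubini is needed; the only analytic input
besides the two hypotheses is the measurability of the partial integrals (`Measurable.lintegral_prod_right'`);
continuity of the folded tent and measurability of `ofReal ∘ Γ` along measurable coordinate maps are reused from
the sibling stub module `MonotoneBlockingMonotoneBlockingTwoFold` (`continuous_foldedTent`,
`KarlinClass.measurable_ofReal_comp`).
-/

noncomputable section

namespace Summit.CriticalPhenomena.Ising3DConformalLimit.Cruxes.MonotoneBlockingTwo.KarlinScaleTP2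

open MeasureTheory Set
open scoped BigOperators ENNReal

namespace FoldedBlockIntegralTP2

/-! ## Non-negativity and measurability of the factors of the integrand -/

/-- The folded tent is non-negative. -/
theorem foldedTent_nonneg (t : ℝ) (m : ℕ) : 0 ≤ foldedTent t m :=
  add_nonneg (le_max_left _ _) (le_max_left _ _)

/-- `t ↦ S(t,m)` is measurable as an `ℝ≥0∞`-valued function (the folded tent is continuous,
`continuous_foldedTent` of the sibling module `…MonotoneBlockingTwoFold`). -/
theorem measurable_Se (m : ℕ) : Measurable fun t : ℝ => ENNReal.ofReal (foldedTent t m) :=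
  ENNReal.measurable_ofReal.comp (continuous_foldedTent m).measurable

/-! ## Pointwise TP₂ of the factors, in `ℝ≥0∞` -/

/-- The folded-tent TP₂ inequality (hypothesis `Sig.stub_foldedTent_tp2`) pushed into `ℝ≥0∞`. -/
theorem Se_tp2 (hT : Sig.stub_foldedTent_tp2) {t t' : ℝ} (m m' : ℕ) (ht : 0 ≤ t) (ht' : 0 ≤ t') :
    ENNReal.ofReal (foldedTent t m) * ENNReal.ofReal (foldedTent t' m') ≤
      ENNReal.ofReal (foldedTent (max t t') (max m m')) *
        ENNReal.ofReal (foldedTent (min t t') (min m m')) := by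
  rw [← ENNReal.ofReal_mul (foldedTent_nonneg _ _), ← ENNReal.ofReal_mul (foldedTent_nonneg _ _)]
  exact ENNReal.ofReal_le_ofReal (hT t t' m m' ht ht')

/-- The class axiom `KarlinClass.mtp2` pushed into `ℝ≥0∞`. -/
theorem Ge_mtp2 {Γ : ℝ → ℝ → ℝ → ℝ} (hK : KarlinClass Γ) {L L' a b c a' b' c' : ℝ}
    (hL : 0 < L) (hL' : 0 < L') (ha : 0 < a) (hb : 0 < b) (hc : 0 < c)
    (ha' : 0 < a') (hb' : 0 < b') (hc' : 0 < c') :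
    ENNReal.ofReal (Γ (L * a) (L * b) (L * c)) * ENNReal.ofReal (Γ (L' * a') (L' * b') (L' * c')) ≤
      ENNReal.ofReal (Γ (max L L' * max a a') (max L L' * max b b') (max L L' * max c c')) *
        ENNReal.ofReal (Γ (min L L' * min a a') (min L L' * min b b') (min L L' * min c c')) := by
  rw [← ENNReal.ofReal_mul (hK.nonneg _ _ _), ← ENNReal.ofReal_mul (hK.nonneg _ _ _)]
  exact ENNReal.ofReal_le_ofReal (hK.mtp2 L L' a b c a' b' c' hL hL' ha hb hc ha' hb' hc')

/-- Products of TP₂ pairs are TP₂ (a regrouping of `mul_le_mul'`). -/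
theorem mul_tp2 {x₁ x₂ x₃ x₄ y₁ y₂ y₃ y₄ : ℝ≥0∞} (hx : x₁ * x₂ ≤ x₃ * x₄) (hy : y₁ * y₂ ≤ y₃ * y₄) :
    x₁ * y₁ * (x₂ * y₂) ≤ x₃ * y₃ * (x₄ * y₄) := by
  rw [mul_mul_mul_comm x₁, mul_mul_mul_comm x₃]
  exact mul_le_mul' hx hy

/-! ## Measurability of the partial integrals -/

/-- The innermost partial integral `H₁(L,a,b,m) = ∫_{(0,∞)} S(c,m) Γ(La,Lb,Lc) dc` is jointly measurable
in `(a, b)`. -/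
theorem measurable_lintegral₁ {Γ : ℝ → ℝ → ℝ → ℝ} (hK : KarlinClass Γ) (L : ℝ) (m : ℕ) :
    Measurable fun p : ℝ × ℝ => ∫⁻ c in Ioi (0:ℝ),
      ENNReal.ofReal (foldedTent c m) * ENNReal.ofReal (Γ (L * p.1) (L * p.2) (L * c)) := by
  have hF : Measurable fun q : (ℝ × ℝ) × ℝ =>
      ENNReal.ofReal (foldedTent q.2 m) * ENNReal.ofReal (Γ (L * q.1.1) (L * q.1.2) (L * q.2)) :=
    ((measurable_Se m).comp measurable_snd).mul
      (hK.measurable_ofReal_comp (measurable_fst.fst.const_mul L) (measurable_fst.snd.const_mul L)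
        (measurable_snd.const_mul L))
  exact hF.lintegral_prod_right'

/-- The second partial integral `H₂(L,a,m₂,m₃) = ∫_{(0,∞)} S(b,m₂) H₁(L,a,b,m₃) db` is measurable in `a`. -/
theorem measurable_lintegral₂ {Γ : ℝ → ℝ → ℝ → ℝ} (hK : KarlinClass Γ) (L : ℝ) (m₂ m₃ : ℕ) :
    Measurable fun a : ℝ => ∫⁻ b in Ioi (0:ℝ), ENNReal.ofReal (foldedTent b m₂) *
      ∫⁻ c in Ioi (0:ℝ), ENNReal.ofReal (foldedTent c m₃) *
        ENNReal.ofReal (Γ (L * a) (L * b) (L * c)) := by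
  have hF : Measurable fun q : ℝ × ℝ => ENNReal.ofReal (foldedTent q.2 m₂) *
      ∫⁻ c in Ioi (0:ℝ), ENNReal.ofReal (foldedTent c m₃) *
        ENNReal.ofReal (Γ (L * q.1) (L * q.2) (L * c)) :=
    ((measurable_Se m₂).comp measurable_snd).mul (measurable_lintegral₁ hK L m₃)
  exact hF.lintegral_prod_right'

/-! ## The three marginalisations -/

/-- STEP 1: `H₁(L,a,b,m) = ∫_{(0,∞)} S(c,m) Γ(La,Lb,Lc) dc` is MTP₂ in `(L, a, b, m) ∈ (0,∞)³ × ℕ`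
(four functions in the variable `c`; the pointwise hypothesis is tent TP₂ times the class axiom `mtp2`). -/
theorem lintegral₁_tp2 (hFF : Sig.stub_fourFunctions) (hT : Sig.stub_foldedTent_tp2)
    {Γ : ℝ → ℝ → ℝ → ℝ} (hK : KarlinClass Γ) {L L' a a' b b' : ℝ} (m m' : ℕ)
    (hL : 0 < L) (hL' : 0 < L') (ha : 0 < a) (ha' : 0 < a') (hb : 0 < b) (hb' : 0 < b') :
    (∫⁻ c in Ioi (0:ℝ), ENNReal.ofReal (foldedTent c m) * ENNReal.ofReal (Γ (L * a) (L * b) (L * c))) *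
        (∫⁻ c in Ioi (0:ℝ), ENNReal.ofReal (foldedTent c m') *
          ENNReal.ofReal (Γ (L' * a') (L' * b') (L' * c))) ≤
      (∫⁻ c in Ioi (0:ℝ), ENNReal.ofReal (foldedTent c (max m m')) *
          ENNReal.ofReal (Γ (max L L' * max a a') (max L L' * max b b') (max L L' * c))) *
        (∫⁻ c in Ioi (0:ℝ), ENNReal.ofReal (foldedTent c (min m m')) *
          ENNReal.ofReal (Γ (min L L' * min a a') (min L L' * min b b') (min L L' * c))) :=
  hFF volume (Ioi 0) measurableSet_Ioi
    (fun c => ENNReal.ofReal (foldedTent c m) * ENNReal.ofReal (Γ (L * a) (L * b) (L * c)))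
    (fun c => ENNReal.ofReal (foldedTent c m') * ENNReal.ofReal (Γ (L' * a') (L' * b') (L' * c)))
    (fun c => ENNReal.ofReal (foldedTent c (max m m')) *
      ENNReal.ofReal (Γ (max L L' * max a a') (max L L' * max b b') (max L L' * c)))
    (fun c => ENNReal.ofReal (foldedTent c (min m m')) *
      ENNReal.ofReal (Γ (min L L' * min a a') (min L L' * min b b') (min L L' * c)))
    ((measurable_Se _).mul
      (hK.measurable_ofReal_comp measurable_const measurable_const (measurable_id.const_mul _)))
    ((measurable_Se _).mul
      (hK.measurable_ofReal_comp measurable_const measurable_const (measurable_id.const_mul _)))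
    ((measurable_Se _).mul
      (hK.measurable_ofReal_comp measurable_const measurable_const (measurable_id.const_mul _)))
    ((measurable_Se _).mul
      (hK.measurable_ofReal_comp measurable_const measurable_const (measurable_id.const_mul _)))
    (fun c (hc : 0 < c) c' (hc' : 0 < c') => mul_tp2 (Se_tp2 hT m m' hc.le hc'.le)
      (Ge_mtp2 hK hL hL' ha hb hc ha' hb' hc'))

/-- STEP 2: `H₂(L,a,m₂,m₃) = ∫_{(0,∞)} S(b,m₂) H₁(L,a,b,m₃) db` is MTP₂ in `(L, a, m₂, m₃) ∈ (0,∞)² × ℕ²`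
(four functions in the variable `b`; the pointwise hypothesis is tent TP₂ times STEP 1). -/
theorem lintegral₂_tp2 (hFF : Sig.stub_fourFunctions) (hT : Sig.stub_foldedTent_tp2)
    {Γ : ℝ → ℝ → ℝ → ℝ} (hK : KarlinClass Γ) {L L' a a' : ℝ} (m₂ m₂' m₃ m₃' : ℕ)
    (hL : 0 < L) (hL' : 0 < L') (ha : 0 < a) (ha' : 0 < a') :
    (∫⁻ b in Ioi (0:ℝ), ENNReal.ofReal (foldedTent b m₂) *
        ∫⁻ c in Ioi (0:ℝ), ENNReal.ofReal (foldedTent c m₃) *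
          ENNReal.ofReal (Γ (L * a) (L * b) (L * c))) *
        (∫⁻ b in Ioi (0:ℝ), ENNReal.ofReal (foldedTent b m₂') *
          ∫⁻ c in Ioi (0:ℝ), ENNReal.ofReal (foldedTent c m₃') *
            ENNReal.ofReal (Γ (L' * a') (L' * b) (L' * c))) ≤
      (∫⁻ b in Ioi (0:ℝ), ENNReal.ofReal (foldedTent b (max m₂ m₂')) *
          ∫⁻ c in Ioi (0:ℝ), ENNReal.ofReal (foldedTent c (max m₃ m₃')) *
            ENNReal.ofReal (Γ (max L L' * max a a') (max L L' * b) (max L L' * c))) *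
        (∫⁻ b in Ioi (0:ℝ), ENNReal.ofReal (foldedTent b (min m₂ m₂')) *
          ∫⁻ c in Ioi (0:ℝ), ENNReal.ofReal (foldedTent c (min m₃ m₃')) *
            ENNReal.ofReal (Γ (min L L' * min a a') (min L L' * b) (min L L' * c))) :=
  hFF volume (Ioi 0) measurableSet_Ioi
    (fun b => ENNReal.ofReal (foldedTent b m₂) *
      ∫⁻ c in Ioi (0:ℝ), ENNReal.ofReal (foldedTent c m₃) *
        ENNReal.ofReal (Γ (L * a) (L * b) (L * c)))
    (fun b => ENNReal.ofReal (foldedTent b m₂') *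
      ∫⁻ c in Ioi (0:ℝ), ENNReal.ofReal (foldedTent c m₃') *
        ENNReal.ofReal (Γ (L' * a') (L' * b) (L' * c)))
    (fun b => ENNReal.ofReal (foldedTent b (max m₂ m₂')) *
      ∫⁻ c in Ioi (0:ℝ), ENNReal.ofReal (foldedTent c (max m₃ m₃')) *
        ENNReal.ofReal (Γ (max L L' * max a a') (max L L' * b) (max L L' * c)))
    (fun b => ENNReal.ofReal (foldedTent b (min m₂ m₂')) *
      ∫⁻ c in Ioi (0:ℝ), ENNReal.ofReal (foldedTent c (min m₃ m₃')) *
        ENNReal.ofReal (Γ (min L L' * min a a') (min L L' * b) (min L L' * c)))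
    ((measurable_Se _).mul ((measurable_lintegral₁ hK _ _).comp measurable_prodMk_left))
    ((measurable_Se _).mul ((measurable_lintegral₁ hK _ _).comp measurable_prodMk_left))
    ((measurable_Se _).mul ((measurable_lintegral₁ hK _ _).comp measurable_prodMk_left))
    ((measurable_Se _).mul ((measurable_lintegral₁ hK _ _).comp measurable_prodMk_left))
    (fun b (hb : 0 < b) b' (hb' : 0 < b') => mul_tp2 (Se_tp2 hT m₂ m₂' hb.le hb'.le)
      (lintegral₁_tp2 hFF hT hK m₃ m₃' hL hL' ha ha' hb hb'))

/-- STEP 3: `H₃(L,m₁,m₂,m₃) = ∫_{(0,∞)} S(a,m₁) H₂(L,a,m₂,m₃) da` (which is `foldedBlockIntegral Γ L n` at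
`n = (m₁,m₂,m₃)`, definitionally) is MTP₂ in `(L, m₁, m₂, m₃) ∈ (0,∞) × ℕ³` (four functions in the
variable `a`; the pointwise hypothesis is tent TP₂ times STEP 2). -/
theorem lintegral₃_tp2 (hFF : Sig.stub_fourFunctions) (hT : Sig.stub_foldedTent_tp2)
    {Γ : ℝ → ℝ → ℝ → ℝ} (hK : KarlinClass Γ) {L L' : ℝ} (m₁ m₁' m₂ m₂' m₃ m₃' : ℕ)
    (hL : 0 < L) (hL' : 0 < L') :
    (∫⁻ a in Ioi (0:ℝ), ENNReal.ofReal (foldedTent a m₁) *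
        ∫⁻ b in Ioi (0:ℝ), ENNReal.ofReal (foldedTent b m₂) *
          ∫⁻ c in Ioi (0:ℝ), ENNReal.ofReal (foldedTent c m₃) *
            ENNReal.ofReal (Γ (L * a) (L * b) (L * c))) *
        (∫⁻ a in Ioi (0:ℝ), ENNReal.ofReal (foldedTent a m₁') *
          ∫⁻ b in Ioi (0:ℝ), ENNReal.ofReal (foldedTent b m₂') *
            ∫⁻ c in Ioi (0:ℝ), ENNReal.ofReal (foldedTent c m₃') *
              ENNReal.ofReal (Γ (L' * a) (L' * b) (L' * c))) ≤
      (∫⁻ a in Ioi (0:ℝ), ENNReal.ofReal (foldedTent a (max m₁ m₁')) *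
          ∫⁻ b in Ioi (0:ℝ), ENNReal.ofReal (foldedTent b (max m₂ m₂')) *
            ∫⁻ c in Ioi (0:ℝ), ENNReal.ofReal (foldedTent c (max m₃ m₃')) *
              ENNReal.ofReal (Γ (max L L' * a) (max L L' * b) (max L L' * c))) *
        (∫⁻ a in Ioi (0:ℝ), ENNReal.ofReal (foldedTent a (min m₁ m₁')) *
          ∫⁻ b in Ioi (0:ℝ), ENNReal.ofReal (foldedTent b (min m₂ m₂')) *
            ∫⁻ c in Ioi (0:ℝ), ENNReal.ofReal (foldedTent c (min m₃ m₃')) *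
              ENNReal.ofReal (Γ (min L L' * a) (min L L' * b) (min L L' * c))) :=
  hFF volume (Ioi 0) measurableSet_Ioi
    (fun a => ENNReal.ofReal (foldedTent a m₁) *
      ∫⁻ b in Ioi (0:ℝ), ENNReal.ofReal (foldedTent b m₂) *
        ∫⁻ c in Ioi (0:ℝ), ENNReal.ofReal (foldedTent c m₃) *
          ENNReal.ofReal (Γ (L * a) (L * b) (L * c)))
    (fun a => ENNReal.ofReal (foldedTent a m₁') *
      ∫⁻ b in Ioi (0:ℝ), ENNReal.ofReal (foldedTent b m₂') *
        ∫⁻ c in Ioi (0:ℝ), ENNReal.ofReal (foldedTent c m₃') *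
          ENNReal.ofReal (Γ (L' * a) (L' * b) (L' * c)))
    (fun a => ENNReal.ofReal (foldedTent a (max m₁ m₁')) *
      ∫⁻ b in Ioi (0:ℝ), ENNReal.ofReal (foldedTent b (max m₂ m₂')) *
        ∫⁻ c in Ioi (0:ℝ), ENNReal.ofReal (foldedTent c (max m₃ m₃')) *
          ENNReal.ofReal (Γ (max L L' * a) (max L L' * b) (max L L' * c)))
    (fun a => ENNReal.ofReal (foldedTent a (min m₁ m₁')) *
      ∫⁻ b in Ioi (0:ℝ), ENNReal.ofReal (foldedTent b (min m₂ m₂')) *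
        ∫⁻ c in Ioi (0:ℝ), ENNReal.ofReal (foldedTent c (min m₃ m₃')) *
          ENNReal.ofReal (Γ (min L L' * a) (min L L' * b) (min L L' * c)))
    ((measurable_Se _).mul (measurable_lintegral₂ hK _ _ _))
    ((measurable_Se _).mul (measurable_lintegral₂ hK _ _ _))
    ((measurable_Se _).mul (measurable_lintegral₂ hK _ _ _))
    ((measurable_Se _).mul (measurable_lintegral₂ hK _ _ _))
    (fun a (ha : 0 < a) a' (ha' : 0 < a') => mul_tp2 (Se_tp2 hT m₁ m₁' ha.le ha'.le)
      (lintegral₂_tp2 hFF hT hK m₂ m₂' m₃ m₃' hL hL' ha ha'))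

end FoldedBlockIntegralTP2

open FoldedBlockIntegralTP2 in
/-- **Stub 3 of line `Sketch` (the engine).** For `Γ ∈ 𝒦` the folded scaled block integral is MTP₂ in
`(L, n) ∈ (0,∞) × ℕ³`:
`foldedBlockIntegral Γ L n · foldedBlockIntegral Γ L' n' ≤ foldedBlockIntegral Γ (L ∨ L') (n ⊔ n') · foldedBlockIntegral Γ (L ∧ L') (n ⊓ n')`,
given the continuous four-functions theorem on a chain and the TP₂ property of the folded tent (the two
hypotheses of `Sig.stub_foldedBlockIntegral_tp2`). Three marginalisations of the MTP₂ integrand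
`Γ(Ls) · Π S(sᵢ,nᵢ)` (`lintegral₁_tp2`, `lintegral₂_tp2`, `lintegral₃_tp2`); the last step is
`lintegral₃_tp2` at `mᵢ = n i`, `mᵢ' = n' i`, up to unfolding `foldedBlockIntegral` and
`(n ⊔ n') i = max (n i) (n' i)`. -/
theorem stub_foldedBlockIntegral_tp2 : Sig.stub_foldedBlockIntegral_tp2 :=
  fun hFF hT _ hK _ _ n n' hL hL' =>
    lintegral₃_tp2 hFF hT hK (n 0) (n' 0) (n 1) (n' 1) (n 2) (n' 2) hL hL'

end Summit.CriticalPhenomena.Ising3DConformalLimit.Cruxes.MonotoneBlockingTwo.KarlinScaleTP2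

end
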